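import Literature.IUT.HodgeTheaters.StableCurveTemperedDataOfSpecialFibreSec2OneCallA3ByName
import Literature.IUT.HodgeTheaters.StableCurveTemperedDataOfSpecialFibreSec2OneCallDdOfChart
import HarnessLib

/-!
# The §2 one-call of record at abc-iut-L3's OWN decomposition data with the last law PRINT-FAITHFUL: every (ii)-law of
# [IUTchI] Prop. 2.4 / Cor. 2.5 stated at `decompositionDataOfChart (R j) ι_j` — no free `Dd` ([IUTchI] pp. 50–51; [SemiAnbd] p. 65)

S. Mochizuki, *Inter-universal Teichmüller theory I*, kurims manuscript (May 2020), §2: proof of Prop. 2.4 (ii), p. 50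
l. 52 – p. 51 l. 21, and Cor. 2.5, p. 51 l. 36 ff. [cite: Mochizuki2012, Prop 2.4(ii) pp.50-51] [cite: Mochizuki2012, Cor 2.5 p.51]
(D-0012 claim key; series status DISPUTED — nothing of the series is asserted here).  Read on the page (p. 51 l. 2–8):

> "… to the vertices “`v″`”, “`(v′)^γ`”, one may only conclude that these two vertices either *coincide*, are
> *adjacent*, or *admit a common adjacent vertex*; but this is still sufficient to conclude the *temperedness* of
> “`(v′)^γ`” from that of “`v″`”."

S. Mochizuki, *Semi-graphs of anabelioids*, Publ. RIMS **42** (2006), kurims manuscript p. 65 l. 8–14 ("for every vertex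
`v` of `𝔾`, we obtain an associated decomposition group `Π^temp_{𝔊,v} ⊆ Π^temp_𝔊` [well-defined up to conjugation in
`Π^temp_𝔊`], which … may be thought of as the commensurator in `Π^temp_𝔊` of `Π^temp_{𝔾,v}`") and Rmk 5.3.1, p. 65
l. 64–65 ("all verticial and edge-like subgroups of `Π^temp_𝔊` are compact and arithmetically ample")
[cite: MochizukiSemiAnbd2006, §5 p.65] [cite: MochizukiSemiAnbd2006, Rmk 5.3.1, p. 65]; Y. Hoshi, S. Mochizuki, *On the
combinatorial anabelian geometry of nodally nondegenerate outer representations*, Hiroshima Math. J. **41** (2011),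
Prop. 3.9 (i) p. 322 [cite: HoshiMochizukiNodNon2011, Prop 3.9 (i) p.322] (the trichotomy; [AbsTopII] Prop 1.3 (iv) p. 11
for the refined clauses [cite: MochizukiAbsTopII2013, Prop 1.3 (iv) p.11]).

PROOF-ONLY file (abc-iut cell, L5 [IUTchI] §2 lineage; seat abc-iut-L5-t11 gen 16, self-offered support row
«SEC2-ONECALL-BYNAME@CHART»; no definition, no instance, no notation, no new `Prop` fact).  It is the KNIT of two
re-keys of the §2 one-call `prop24_cor25_ofPiData_byName_noRF_frame` (abc-iut-L5-t11 gen 13, p493190) that were landed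
independently, read through abc-iut-L5-t9 gen 8's by-name bridges (p517444 over abc-iut-L3's guest DEFS p516099):

* abc-iut-w4-d058 gen 12, `StableCurveTemperedDataOfSpecialFibreSec2OneCallDdOfChart.lean` (p504001): the FREE per-level
  decomposition data `{V B : ℕ → Type*} (Dd : ∀ j, DecompositionData Π^tp_j (V j) (B j))` are ELIMINATED in favour of ONE
  displayed DATA binder `R : ∀ j, ChartRepresentatives (T.chart j)` (a compatible choice of the §3 representatives,
  [SemiAnbd] Thm 3.7 (i)(iii)), the data being abc-iut-L3's PRODUCED `decompositionDataOfChart (R j) ι_j` over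
  `Π^tp_j := Π^temp_{X_K} ⧸ admKer_j` — verticial groups the p. 65 commensurators `arithVertGp (R j) ι_j v`
  (`decompositionDataOfChart_vertGp`, `rfl`), `ι_j : π₁^temp(𝒢_j) ↪ Π^tp_j` the level embedding (the Mathlib lift of the level
  inclusion along the admissible surjection `adm_j`, written out below exactly as in p504001) — with the last (ii)-law in
  its E-free form (A3′)_j;
* abc-iut-L5-t11 gen 15, `StableCurveTemperedDataOfSpecialFibreSec2A3Trichotomy.lean` (p506978): over FREE `Dd j`, the last
  law in PRINT-FAITHFUL form — `hVc_j` ([SemiAnbd] Rmk 5.3.1: compact verticial groups), arithmetic ENDPOINT DATA of `Dd j`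
  with its seven side conditions, and `hA3tri_j` (the [AbsTopII] Prop 1.3 (iv)-refined / [NodNon] Prop 3.9 (i) trichotomy in
  coset coordinates, stabilisers = CLOSURES) — the printed «still sufficient» step being the theorem
  `A3prime_of_trichotomy_of_isCompact` (`hVc ∧ hA3tri ⇒ (A3′)_j`); abc-iut-L5-t9 gen 8,
  `StableCurveTemperedDataOfSpecialFibreSec2OneCallA3ByName.lean` (p517444), NAMES both: `hVc_j` ⟸ abc-iut-L3's [SemiAnbd]
  Rmk 5.3.1 predicate `VerticialEdgeLikeCompactAmpleStatement` (`hVc_of_verticialEdgeLikeCompactAmpleStatement`) and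
  `hA3tri_j` := abc-iut-L3's guest-filed [NodNon] Prop 3.9 (i) predicate `DecompositionData.ArithCosetTreeTrichotomy`
  (`SemiGraphs/NodNonArithCosetTreeTrichotomy.lean`, p516099, abc-iut-L3-lead ruling δ43) BY NAME, definitionally
  (`hA3tri_of_arithCosetTreeTrichotomy`).

THIS FILE states BOTH at once: the two one-calls `prop24_cor25_ofPiData_byName_noRF_frame_of_isFreeOrSurface_trichotomy_ofChart`
((x′)-keyed) and `…_of_freePro_trichotomy_ofChart` ((x)-keyed), whose (ii)-binders are ALL stated at abc-iut-L3's own produced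
data `decompositionDataOfChart (R j) ι_j`: `hI_j^frame` = abc-iut-L3's [SemiAnbd] Thm 5.4 (i) predicate
`ArithMaximalCompactStatementI` (as in p504001); `hVcS_j` = abc-iut-L3's [SemiAnbd] Rmk 5.3.1 predicate
`VerticialEdgeLikeCompactAmpleStatement` at the SAME canonical Prop 5.2 (iv) frame (compactness extracted by p506978 § A
`ArithTrichotomyTransfer.isCompact_vertGp_of_verticialEdgeLikeCompactAmple`); arithmetic endpoint data bound to the
level-`j` special fibre `𝒢_j`'s OWN vertices / branches / edges; and `hA3_j` = abc-iut-L3's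
`DecompositionData.ArithCosetTreeTrichotomy (decompositionDataOfChart (R j) ι_j) ι_j (q̂_j ∘ toHat) (Π^temp_{X_K} ↠ G_K)`.
PROOF: p504001's `…_A3prime_ofChart` one-calls fed with p506978's `A3prime_of_trichotomy_of_isCompact` at that `Dd`, its
`hVc`/`hA3tri` inputs supplied by p517444's two bridges (definitional bookkeeping only).

LAW CENSUS after this file (abc-iut-L5-lead RULINGS #110 (4) grammar), for the token holder's pen — DATA {`X`, `d`, `S`,
`Σ ⊆ Σ̂` + side conditions, `TpH`/`HatH`/`hle`, `cuspMeetsH`, `T`, `P : PiData`, a cusp `x`, per-level PSC data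
`G_i`/`σ`/`Λv`/node data, `R`, arithmetic endpoint data of the produced data + 7 side conditions} · FACT BY NAME {`hNN_i` =
F-2540 `PSCDatum.VerticialIntersectionNear` · `hI_j^frame` = [SemiAnbd] Thm 5.4 (i) `ArithMaximalCompactStatementI` ·
`hVcS_j` = [SemiAnbd] Rmk 5.3.1 `VerticialEdgeLikeCompactAmpleStatement` · `hA3_j` = [NodNon] Prop 3.9 (i)
`DecompositionData.ArithCosetTreeTrichotomy` (p516099; F-number per abc-iut-F-lit; GAP G-L5t11g15-1 until minted)} ·
FACT-INSTANCE (x′) `hF`/`e` resp. (x) `hι` · ORIGIN `hab` (G-L5t11g7-1) · GAP `hadm` (G-w4d058-g10-1) · explicit LAW: NONE.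
No free `Dd`; every FACT-class input is a NAMED predicate ABOUT abc-iut-L3's own produced object.  Joint NON-VACUITY of the
chart-bound binder set (`R`, `hVcS_j`, endpoint data, `hA3_j`, `hI_j^frame`): the companion
`StableCurveTemperedDataOfSpecialFibreSec2OneCallA3ByNameOfChartNV.lean` (degenerate one-vertex witness, labelled).

HONEST TAGS.  NOT claimed: that any of Thm 5.4 (i), Rmk 5.3.1 or the trichotomy HOLDS at the produced data (FACT-class
inputs, displayed as hypotheses); that the endpoint side conditions are met at the genuine datum (they are DATA with
displayed constraints; joint inhabitation is the business of an NV companion, not of this file).  `R` is DATA (a choice),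
not a law.  CONDITIONAL as labelled; typed ≠ inhabited ≠ discharged; nothing here asserts that abc is proved or refuted,
and nothing here bears on [IUTchIII] Cor. 3.12.
-/

noncomputable section

namespace Literature.IUT.HodgeTheaters

open _root_.Topology
open scoped Pointwise
open Literature.AnabelianGeometry.SemiGraphs Literature.AnabelianGeometry.SemiGraphs.ProfiniteSemiGraph
open Literature.AnabelianGeometry.SemiGraphs.SemiGraphOfAnabelioids (IsProSigmaCompletion)

universe uE

namespace StableCurveTemperedData

namespace OfSpecialFibre

variable {p : ℕ} [Fact p.Prime] (X : TemperedCurve p)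

section OneCallOfChart

variable (d : X.GroupLevelData) (T : SpecialFibreTower X.DeltaTemp)
  (Sigma SigmaHat : Set ℕ) (hsub : Sigma ⊆ SigmaHat) (hne : Set.Nonempty Sigma)
  (hprime : ∀ q ∈ SigmaHat, q.Prime)
  (S : SpecialFibreData (X.toTemperedArithmeticGroup d)) (h36 : S.Gc.Prop36Hypotheses)
  (hp : p ∉ Sigma) (TpH : Subgroup S.chart.G)
  (HatH : Subgroup (TemperedGraphGroupData.exists_completion_of_prop36 S.Gc h36 S.chart).choose)
  (hle : TpH.map (TemperedGraphGroupData.exists_completion_of_prop36 S.Gc h36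
    S.chart).choose_spec.choose.toMonoidHom ≤ HatH)
  (cuspMeetsH : {x : X.Pt // X.IsCusp x} → Prop)

/-! #### The chart-bound binder set (section variables, shared by the theorems below)

* `R` — DATA: a compatible choice of the §3 verticial / edge-like representatives of the level-`j` special fibre
  `𝒢_j` ([SemiAnbd] Thm 3.7 (i)(iii), "well-defined up to conjugation"); the level-`j` arithmetic decomposition data are
  then abc-iut-L3's PRODUCED `decompositionDataOfChart (R j) ι_j` over `Π^tp_j` (verticial groups = the p. 65
  commensurators `arithVertGp (R j) ι_j v`, `decompositionDataOfChart_vertGp` is `rfl`), `ι_j` the level embedding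
  `π₁^temp(𝒢_j) ↪ Π^tp_j` of abc-iut-w4-d058 gen 12 (p504001), written out as the Mathlib lift it is;
* `hVcS` — [SemiAnbd] Rmk 5.3.1 BY NAME: abc-iut-L3's `VerticialEdgeLikeCompactAmpleStatement` at the produced data and the
  canonical Prop 5.2 (iv) frame `πA_j : Π^tp_j ↠ Π^tp_j ⧸ N̄_j` (the SAME frame as `hI_j`); only its compactness half is used;
* arithmetic ENDPOINT DATA of the produced data ([NodNon] Def 1.1 (vi), Lem 1.7 / 1.8 in coset coordinates): nodes `EA j`,
  two DISTINCT branches `β₁A j e ≠ β₂A j e` of ONE edge of `𝒢_j` abutting to `srcA j e`, `tgtA j e`, tempered end-point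
  conjugators `c₁A j e, c₂A j e ∈ Π^tp_j` identifying the two branch groups (`hΓA`), the no-loop clause `hloopA` and the
  coverage clause `hcovA` — exactly p506978's side conditions, now over `𝒢_j`'s OWN `edgeOf` / `abuts` and the p. 65
  commensurators `arithBrGp` / `arithVertGp` (the produced data's `edgeOf` / `abut` / `brGp` / `vertGp`, all by `rfl`);
* `hA3` — [NodNon] Prop 3.9 (i) / [AbsTopII] Prop 1.3 (iv)-refined BY NAME: abc-iut-L3's guest-filed predicate
  `DecompositionData.ArithCosetTreeTrichotomy` (p516099) at the produced data, the level inclusion `ι_j : Π^tp_j → Π̂_j`,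
  `q̂_j ∘ toHat : Π^temp_{X_K} → Π̂_j` and the augmentation `Π^temp_{X_K} ↠ G_K` (stabilisers = the CLOSURES
  `closure ι_j(D_v) ≤ Π̂_j`); by p517444's `hA3tri_of_arithCosetTreeTrichotomy` it unfolds, definitionally, to p506978's
  `hA3tri` with `Dd j := decompositionDataOfChart (R j) ι_j`.  A displayed hypothesis, NEVER asserted (FACT-class). -/

variable (P : SpecialFibreTower.PiData X d S T)
  -- (ii) DATA: a compatible CHOICE of §3 representatives at every level ([SemiAnbd] Thm 3.7 (i)(iii)); replaces {V, B, Dd}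
  (R : ∀ j, ChartRepresentatives (T.chart j))
  -- (ii) FACT BY NAME: [SemiAnbd] Rmk 5.3.1 (abc-iut-L3's predicate) at the PRODUCED data, canonical Prop 5.2 (iv) frame
  (hVcS : ∀ j, haveI := qTower_map_N_normal X d T Sigma SigmaHat hsub hne hprime S h36 hp TpH HatH hle cuspMeetsH P j;
    VerticialEdgeLikeCompactAmpleStatement
      (decompositionDataOfChart (R j) ((T.adm j).toMonoidHom.liftOfSurjective (T.adm_surjective j)
          ⟨(((qTowerOfSpecialFibreTower X T d S h36 Sigma SigmaHat hsub hne hprime hp TpH HatH hle cuspMeetsH P.admKer_normal_pi).qtp j).comp X.DeltaTemp.subtype).comp (T.N j).subtype,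
            ker_adm_le_ker_levelIncl X d T Sigma SigmaHat hsub hne hprime S h36 hp TpH HatH hle cuspMeetsH P j⟩))
      (QuotientGroup.mk' (((T.N j).map X.DeltaTemp.subtype).map ((qTowerOfSpecialFibreTower X T d S h36 Sigma SigmaHat hsub hne hprime hp TpH HatH hle cuspMeetsH P.admKer_normal_pi).qtp j))))
  -- (ii) DATA: arithmetic ENDPOINT DATA bound to the level-`j` special fibre's OWN edges / branches / vertices
  {EA : ℕ → Type uE} (β₁A β₂A : ∀ j, EA j → (T.Gc j).graph.Branch) (srcA tgtA : ∀ j, EA j → (T.Gc j).graph.Vertex)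
  (c₁A c₂A : ∀ j, EA j → ((qTowerOfSpecialFibreTower X T d S h36 Sigma SigmaHat hsub hne hprime hp TpH HatH hle cuspMeetsH P.admKer_normal_pi).Q j).Tp)
  (hβe : ∀ j e, (T.Gc j).graph.edgeOf (β₁A j e) = (T.Gc j).graph.edgeOf (β₂A j e))
  (hβne : ∀ j e, β₁A j e ≠ β₂A j e)
  (hsrcA : ∀ j e, (T.Gc j).graph.abuts (β₁A j e) = some (srcA j e))
  (htgtA : ∀ j e, (T.Gc j).graph.abuts (β₂A j e) = some (tgtA j e))
  (hΓA : ∀ j e, MulAut.conj (c₁A j e) • (arithBrGp (R j) ((T.adm j).toMonoidHom.liftOfSurjective (T.adm_surjective j)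
          ⟨(((qTowerOfSpecialFibreTower X T d S h36 Sigma SigmaHat hsub hne hprime hp TpH HatH hle cuspMeetsH P.admKer_normal_pi).qtp j).comp X.DeltaTemp.subtype).comp (T.N j).subtype,
            ker_adm_le_ker_levelIncl X d T Sigma SigmaHat hsub hne hprime S h36 hp TpH HatH hle cuspMeetsH P j⟩) (β₁A j e)) =
    MulAut.conj (c₂A j e) • (arithBrGp (R j) ((T.adm j).toMonoidHom.liftOfSurjective (T.adm_surjective j)
          ⟨(((qTowerOfSpecialFibreTower X T d S h36 Sigma SigmaHat hsub hne hprime hp TpH HatH hle cuspMeetsH P.admKer_normal_pi).qtp j).comp X.DeltaTemp.subtype).comp (T.N j).subtype,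
            ker_adm_le_ker_levelIncl X d T Sigma SigmaHat hsub hne hprime S h36 hp TpH HatH hle cuspMeetsH P j⟩) (β₂A j e)))
  (hloopA : ∀ j e, srcA j e = tgtA j e → (c₁A j e)⁻¹ * c₂A j e ∉ (arithVertGp (R j) ((T.adm j).toMonoidHom.liftOfSurjective (T.adm_surjective j)
          ⟨(((qTowerOfSpecialFibreTower X T d S h36 Sigma SigmaHat hsub hne hprime hp TpH HatH hle cuspMeetsH P.admKer_normal_pi).qtp j).comp X.DeltaTemp.subtype).comp (T.N j).subtype,
            ker_adm_le_ker_levelIncl X d T Sigma SigmaHat hsub hne hprime S h36 hp TpH HatH hle cuspMeetsH P j⟩) (srcA j e)))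
  (hcovA : ∀ (j : ℕ) (b b' : (T.Gc j).graph.Branch) (v w : (T.Gc j).graph.Vertex), (T.Gc j).graph.edgeOf b = (T.Gc j).graph.edgeOf b' → b ≠ b' →
    (T.Gc j).graph.abuts b = some v → (T.Gc j).graph.abuts b' = some w →
      ∃ e, (β₁A j e = b ∧ β₂A j e = b') ∨ (β₁A j e = b' ∧ β₂A j e = b))
  -- (ii) FACT BY NAME: [NodNon] Prop 3.9 (i) / [AbsTopII] Prop 1.3 (iv)-refined — abc-iut-L3's guest-filed predicate
  -- `DecompositionData.ArithCosetTreeTrichotomy` (p516099) AT THE PRODUCED DATA (stabilisers = closures in `Π̂_j`)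
  (hA3 : ∀ j, DecompositionData.ArithCosetTreeTrichotomy.{uE}
      (decompositionDataOfChart (R j) ((T.adm j).toMonoidHom.liftOfSurjective (T.adm_surjective j)
          ⟨(((qTowerOfSpecialFibreTower X T d S h36 Sigma SigmaHat hsub hne hprime hp TpH HatH hle cuspMeetsH P.admKer_normal_pi).qtp j).comp X.DeltaTemp.subtype).comp (T.N j).subtype,
            ker_adm_le_ker_levelIncl X d T Sigma SigmaHat hsub hne hprime S h36 hp TpH HatH hle cuspMeetsH P j⟩))
      ((qTowerOfSpecialFibreTower X T d S h36 Sigma SigmaHat hsub hne hprime hp TpH HatH hle cuspMeetsH P.admKer_normal_pi).Q j).ι (((qTowerOfSpecialFibreTower X T d S h36 Sigma SigmaHat hsub hne hprime hp TpH HatH hle cuspMeetsH P.admKer_normal_pi).qhat j).comp X.toHat.toMonoidHom) X.augGK.toMonoidHom)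

include hVcS hβe hβne hsrcA htgtA hΓA hloopA hcovA hA3 in
/-- **[IUTchI] Prop. 2.4 (i)(ii)(iii) ∧ Cor. 2.5 at the genuine 𝔛-datum, (x′)-keyed, every (ii)-law stated AT abc-iut-L3's
OWN produced decomposition data**: abc-iut-w4-d058 gen 12's `…_of_isFreeOrSurface_A3prime_ofChart` (p504001, binders
`{V, B, Dd} ↦ R`) with its E-free law (A3′)_j SUPPLIED by abc-iut-L5-t11 gen 15's `A3prime_of_trichotomy_of_isCompact`
(p506978) at `Dd j := decompositionDataOfChart (R j) ι_j`, the compactness `hVc_j` met BY NAME from [SemiAnbd] Rmk 5.3.1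
(`hVcS`, abc-iut-L3's predicate, via p506978 § A `isCompact_vertGp_of_verticialEdgeLikeCompactAmple`).  Displayed laws after
this theorem: `hNN_i` (F-2540 BY NAME) · `hab` (ORIGIN, G-L5t11g7-1) · `hadm` (GAP G-w4d058-g10-1) · `hI_j^frame` ([SemiAnbd]
Thm 5.4 (i), abc-iut-L3's predicate, at the produced data) · `hVcS_j` ([SemiAnbd] Rmk 5.3.1, abc-iut-L3's predicate, at the
produced data) · `hA3_j` ([NodNon] Prop 3.9 (i), abc-iut-L3's guest-filed predicate `DecompositionData.ArithCosetTreeTrichotomy`,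
at the produced data) + the FACT-INSTANCE (x′) `hF`/`e` + the DATA `R` and the endpoint data — explicit LAW none.  No free
`Dd`.  CONDITIONAL as labelled; nothing of [SemiAnbd] Thm 5.4 / Rmk 5.3.1 or of [NodNon] Prop 3.9 (i) is proved here.
[cite: Mochizuki2012, Prop 2.4 pp.50-51] [cite: Mochizuki2012, Cor 2.5 p.51] [cite: MochizukiSemiAnbd2006, §5 p.65] [claim: Mochizuki2012, status: disputed] -/
theorem prop24_cor25_ofPiData_byName_noRF_frame_of_isFreeOrSurface_trichotomy_ofChart
    (x : {x : X.Pt // X.IsCusp x})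
    {F : Type} [Group F] (hF : IsFreeOrSurface F) (e : X.DeltaHat ≃ₜ* profiniteCompletion F)
    (G : ∀ i, PSCDatum (levelGraph X T Sigma SigmaHat hsub hne hprime i).Hat)
    (hNN : ∀ i, (G i).VerticialIntersectionNear)
    (σ : ∀ i, (T.Gc i).graph.Vertex ≃ (G i).graph.V) (Λv : ∀ i, (G i).graph.V → Subgroup (T.chart i).G)
    (hvert : ∀ i (v : (T.Gc i).graph.Vertex), Λv i (σ i v) ∈ verticialSubgroups (T.chart i) v)
    (hΛv : ∀ i v, (Λv i v).map (levelGraph X T Sigma SigmaHat hsub hne hprime i).ι = (G i).vertGp v)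
    (src tgt : ∀ i, (G i).graph.N → (G i).graph.V) (c₁ c₂ : ∀ i, (G i).graph.N → (T.chart i).G)
    (hends : ∀ i e, (G i).graph.nodeEnds e = s(src i e, tgt i e))
    (h₁ : ∀ i e, (G i).nodeGp e ≤
      MulAut.conj ((levelGraph X T Sigma SigmaHat hsub hne hprime i).ι (c₁ i e)) • (G i).vertGp (src i e))
    (h₂ : ∀ i e, (G i).nodeGp e ≤
      MulAut.conj ((levelGraph X T Sigma SigmaHat hsub hne hprime i).ι (c₂ i e)) • (G i).vertGp (tgt i e))
    (hloop : ∀ i e, src i e = tgt i e → (c₁ i e)⁻¹ * c₂ i e ∉ Λv i (src i e))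
    (hab : ∀ (i : ℕ) (A : Type) [CommGroup A] [Finite A] (χ : T.N i →* A),
      IsOpen ((χ.ker : Subgroup (T.N i)) : Set (T.N i)) →
      (∀ q : ℕ, q.Prime → q ∣ Nat.card A → q ∈ Sigma) → (T.adm i).toMonoidHom.ker ≤ χ.ker)
    (hadm : ∀ U ∈ 𝓝 (1 : ↥X.DeltaTemp), ∃ j, ((T.admKer j : Subgroup ↥X.DeltaTemp) : Set ↥X.DeltaTemp) ⊆ U)
    (hI : ∀ j, haveI := qTower_map_N_normal X d T Sigma SigmaHat hsub hne hprime S h36 hp TpH HatH hle cuspMeetsH P j;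
      ArithMaximalCompactStatementI
        (decompositionDataOfChart (R j) ((T.adm j).toMonoidHom.liftOfSurjective (T.adm_surjective j)
          ⟨(((qTowerOfSpecialFibreTower X T d S h36 Sigma SigmaHat hsub hne hprime hp TpH HatH hle cuspMeetsH P.admKer_normal_pi).qtp j).comp X.DeltaTemp.subtype).comp (T.N j).subtype,
            ker_adm_le_ker_levelIncl X d T Sigma SigmaHat hsub hne hprime S h36 hp TpH HatH hle cuspMeetsH P j⟩))
        (QuotientGroup.mk' (((T.N j).map X.DeltaTemp.subtype).map ((qTowerOfSpecialFibreTower X T d S h36 Sigma SigmaHat hsub hne hprime hp TpH HatH hle cuspMeetsH P.admKer_normal_pi).qtp j)))) :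
    ((ofSpecialFibre X d S h36 Sigma SigmaHat hsub hne hprime hp TpH HatH hle cuspMeetsH).Prop24i ∧
      (ofSpecialFibre X d S h36 Sigma SigmaHat hsub hne hprime hp TpH HatH hle cuspMeetsH).Prop24ii ∧
      (ofSpecialFibre X d S h36 Sigma SigmaHat hsub hne hprime hp TpH HatH hle cuspMeetsH).Prop24iii) ∧
    ((ofSpecialFibre X d S h36 Sigma SigmaHat hsub hne hprime hp TpH HatH hle cuspMeetsH).Cor25Decomposition ∧
      (ofSpecialFibre X d S h36 Sigma SigmaHat hsub hne hprime hp TpH HatH hle cuspMeetsH).Cor25Inertia) := by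
  exact prop24_cor25_ofPiData_byName_noRF_frame_of_isFreeOrSurface_A3prime_ofChart X d T Sigma SigmaHat hsub hne
    hprime S h36 hp TpH HatH hle cuspMeetsH P x hF e G hNN σ Λv hvert hΛv src tgt c₁ c₂ hends h₁ h₂ hloop hab hadm R hI
    (A3prime_of_trichotomy_of_isCompact X d T Sigma SigmaHat hsub hne hprime S h36 hp TpH HatH hle cuspMeetsH P
      (fun j => (decompositionDataOfChart (R j) ((T.adm j).toMonoidHom.liftOfSurjective (T.adm_surjective j)
          ⟨(((qTowerOfSpecialFibreTower X T d S h36 Sigma SigmaHat hsub hne hprime hp TpH HatH hle cuspMeetsH P.admKer_normal_pi).qtp j).comp X.DeltaTemp.subtype).comp (T.N j).subtype,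
            ker_adm_le_ker_levelIncl X d T Sigma SigmaHat hsub hne hprime S h36 hp TpH HatH hle cuspMeetsH P j⟩)))
      (hVc_of_verticialEdgeLikeCompactAmpleStatement X d T Sigma SigmaHat hsub hne hprime S h36 hp TpH HatH hle
        cuspMeetsH P _ hVcS)
      β₁A β₂A srcA tgtA c₁A c₂A hβe hβne hsrcA htgtA hΓA hloopA hcovA
      (hA3tri_of_arithCosetTreeTrichotomy X d T Sigma SigmaHat hsub hne hprime S h36 hp TpH HatH hle cuspMeetsH P _ hA3))

include hVcS hβe hβne hsrcA htgtA hΓA hloopA hcovA hA3 in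
/-- **The (x)-keyed twin** (abc-iut-L5-t11 gen 14 / abc-iut-w4-d058 gen 11–12's `…_of_freePro_A3prime_ofChart`, p496636 /
p500641 / p504001): the same one-call with the origin binder in the shape `hι : IsProSigmaCompletion {q | q.Prime} ι`
(`Γ` free; GAP G-w4d052-g6-2) and every (ii)-law a NAMED predicate at the produced data (`hI_j^frame`, `hVcS_j`, `hA3_j`).
CONDITIONAL as labelled.
[cite: Mochizuki2012, Prop 2.4 pp.50-51] [cite: Mochizuki2012, Cor 2.5 p.51] [cite: MochizukiSemiAnbd2006, §5 p.65] [claim: Mochizuki2012, status: disputed] -/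
theorem prop24_cor25_ofPiData_byName_noRF_frame_of_freePro_trichotomy_ofChart
    (x : {x : X.Pt // X.IsCusp x})
    {Γ : Type*} [Group Γ] [IsFreeGroup Γ] {ι : Γ →* X.DeltaHat} (hι : IsProSigmaCompletion {q | q.Prime} ι)
    (G : ∀ i, PSCDatum (levelGraph X T Sigma SigmaHat hsub hne hprime i).Hat)
    (hNN : ∀ i, (G i).VerticialIntersectionNear)
    (σ : ∀ i, (T.Gc i).graph.Vertex ≃ (G i).graph.V) (Λv : ∀ i, (G i).graph.V → Subgroup (T.chart i).G)
    (hvert : ∀ i (v : (T.Gc i).graph.Vertex), Λv i (σ i v) ∈ verticialSubgroups (T.chart i) v)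
    (hΛv : ∀ i v, (Λv i v).map (levelGraph X T Sigma SigmaHat hsub hne hprime i).ι = (G i).vertGp v)
    (src tgt : ∀ i, (G i).graph.N → (G i).graph.V) (c₁ c₂ : ∀ i, (G i).graph.N → (T.chart i).G)
    (hends : ∀ i e, (G i).graph.nodeEnds e = s(src i e, tgt i e))
    (h₁ : ∀ i e, (G i).nodeGp e ≤
      MulAut.conj ((levelGraph X T Sigma SigmaHat hsub hne hprime i).ι (c₁ i e)) • (G i).vertGp (src i e))
    (h₂ : ∀ i e, (G i).nodeGp e ≤
      MulAut.conj ((levelGraph X T Sigma SigmaHat hsub hne hprime i).ι (c₂ i e)) • (G i).vertGp (tgt i e))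
    (hloop : ∀ i e, src i e = tgt i e → (c₁ i e)⁻¹ * c₂ i e ∉ Λv i (src i e))
    (hab : ∀ (i : ℕ) (A : Type) [CommGroup A] [Finite A] (χ : T.N i →* A),
      IsOpen ((χ.ker : Subgroup (T.N i)) : Set (T.N i)) →
      (∀ q : ℕ, q.Prime → q ∣ Nat.card A → q ∈ Sigma) → (T.adm i).toMonoidHom.ker ≤ χ.ker)
    (hadm : ∀ U ∈ 𝓝 (1 : ↥X.DeltaTemp), ∃ j, ((T.admKer j : Subgroup ↥X.DeltaTemp) : Set ↥X.DeltaTemp) ⊆ U)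
    (hI : ∀ j, haveI := qTower_map_N_normal X d T Sigma SigmaHat hsub hne hprime S h36 hp TpH HatH hle cuspMeetsH P j;
      ArithMaximalCompactStatementI
        (decompositionDataOfChart (R j) ((T.adm j).toMonoidHom.liftOfSurjective (T.adm_surjective j)
          ⟨(((qTowerOfSpecialFibreTower X T d S h36 Sigma SigmaHat hsub hne hprime hp TpH HatH hle cuspMeetsH P.admKer_normal_pi).qtp j).comp X.DeltaTemp.subtype).comp (T.N j).subtype,
            ker_adm_le_ker_levelIncl X d T Sigma SigmaHat hsub hne hprime S h36 hp TpH HatH hle cuspMeetsH P j⟩))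
        (QuotientGroup.mk' (((T.N j).map X.DeltaTemp.subtype).map ((qTowerOfSpecialFibreTower X T d S h36 Sigma SigmaHat hsub hne hprime hp TpH HatH hle cuspMeetsH P.admKer_normal_pi).qtp j)))) :
    ((ofSpecialFibre X d S h36 Sigma SigmaHat hsub hne hprime hp TpH HatH hle cuspMeetsH).Prop24i ∧
      (ofSpecialFibre X d S h36 Sigma SigmaHat hsub hne hprime hp TpH HatH hle cuspMeetsH).Prop24ii ∧
      (ofSpecialFibre X d S h36 Sigma SigmaHat hsub hne hprime hp TpH HatH hle cuspMeetsH).Prop24iii) ∧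
    ((ofSpecialFibre X d S h36 Sigma SigmaHat hsub hne hprime hp TpH HatH hle cuspMeetsH).Cor25Decomposition ∧
      (ofSpecialFibre X d S h36 Sigma SigmaHat hsub hne hprime hp TpH HatH hle cuspMeetsH).Cor25Inertia) := by
  exact prop24_cor25_ofPiData_byName_noRF_frame_of_freePro_A3prime_ofChart X d T Sigma SigmaHat hsub hne hprime S h36
    hp TpH HatH hle cuspMeetsH P x hι G hNN σ Λv hvert hΛv src tgt c₁ c₂ hends h₁ h₂ hloop hab hadm R hI
    (A3prime_of_trichotomy_of_isCompact X d T Sigma SigmaHat hsub hne hprime S h36 hp TpH HatH hle cuspMeetsH P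
      (fun j => (decompositionDataOfChart (R j) ((T.adm j).toMonoidHom.liftOfSurjective (T.adm_surjective j)
          ⟨(((qTowerOfSpecialFibreTower X T d S h36 Sigma SigmaHat hsub hne hprime hp TpH HatH hle cuspMeetsH P.admKer_normal_pi).qtp j).comp X.DeltaTemp.subtype).comp (T.N j).subtype,
            ker_adm_le_ker_levelIncl X d T Sigma SigmaHat hsub hne hprime S h36 hp TpH HatH hle cuspMeetsH P j⟩)))
      (hVc_of_verticialEdgeLikeCompactAmpleStatement X d T Sigma SigmaHat hsub hne hprime S h36 hp TpH HatH hle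
        cuspMeetsH P _ hVcS)
      β₁A β₂A srcA tgtA c₁A c₂A hβe hβne hsrcA htgtA hΓA hloopA hcovA
      (hA3tri_of_arithCosetTreeTrichotomy X d T Sigma SigmaHat hsub hne hprime S h36 hp TpH HatH hle cuspMeetsH P _ hA3))

end OneCallOfChart

end OfSpecialFibre

end StableCurveTemperedData

end Literature.IUT.HodgeTheaters

end
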